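import Literature.NumberTheory.EllipticCurves.EisensteinKroneckerNumbersPartialHeckeL
import Literature.NumberTheory.LFunctions.GrossencharakterWeightOneNorm
import HarnessLib

/-!
# II.3.5 (13) summed over the ray classes for the two-index Eisenstein–Kronecker numbers:
# `Σ_𝔠 χ(𝔠)⁻¹φ(𝔠)^{−(k+j)}·E_{−j,k}(Ω, 𝔠⁻¹𝔪Ω) = (k−1)!·A₀^j·Ω̄^j·Ω^{−k}·L_𝔪(χ⁻¹ N^j φ^{−(k+j)}, 0)` (de Shalit 1987, II.4.14 (36))

Topic `Literature/NumberTheory/EllipticCurves` (complex-lattice cluster); sequel of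
`EisensteinKroneckerNumbersPartialHeckeL.lean` (per class: `E_{−j,k}(Ω, 𝔠⁻¹𝔪Ω) = (k−1)!·A(L)^j·Ω̄^j·Ω^{−k}·
conj(ψ̃𝔠)^{−j}·ψ̃𝔠^k·Σ'_{𝔞∼𝔠} conj(ψ̃𝔞)^j ψ̃𝔞^{−k}`, `k ≥ j + 3`), of `EisensteinNumbersPartialHeckeL.lean` (§2:
the class-sum at `j = 0`) and of `LFunctions/GrossencharakterWeightOneNorm.lean` (`φφ̄ = N` over an
imaginary quadratic field). Theorems only; no definition, no named fact, nothing about BSD.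

THE POINT (de Shalit II.4.14, p. 71–73): the right side of the interpolation formula (36) at a
grossencharacter `ε = φ^k φ̄^{−j} χ` (`0 ≤ j`, `k ≥ j + 3` here; de Shalit's type `(k, −j)`) is built on
`L_𝔣(ε⁻¹, 0) = Σ_{(𝔞,𝔣)=1} χ(𝔞)⁻¹ φ̄(𝔞)^j φ(𝔞)^{−k} = Σ χ⁻¹(𝔞) N𝔞^j φ(𝔞)^{−(k+j)}`, a CONVERGENT series; its
class-by-class pieces are the Eisenstein–Kronecker numbers of the lattices `𝔠⁻¹𝔪Ω` by II.3.5 (13), and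
the factors `A(𝔠⁻¹𝔪Ω)^j = (N𝔠·A₀)^j`, `conj(φ(𝔠))^{−j}·N𝔠^j = φ(𝔠)^j` recombine into `φ(𝔠)^{k+j}`.

## Statements (for `K` imaginary quadratic: `[IsTotallyComplex K]`, `finrank ℚ K = 2`)

With `𝔪 ≠ 0, (1)`, `w_𝔪 = 1`, `ψ̃ = idealPow K ψ` of type `ιK` on the ray (`φ((α)) = α`), `χ` a ray class
character mod `𝔪`, `T` a system of representatives (`IsRayClassReps 𝔪 T`), `Ω ≠ 0`, lattices
`Λ_{L 𝔠} = Ω·ιK(𝔪/𝔠)` with `A(L 𝔠) = N𝔠·A₀` (`A₀ ≠ 0`; `A₀ = A(𝔪Ω)`, II.2.1 (4)/(6) — supplied by the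
`areaInv` files, here a HYPOTHESIS), and `j + 3 ≤ k`:

* `rayClassCoeff_inv_mul_fun_eq_sum` — the coefficient splitting along `T` for any multiplier `f`;
* `idealPow_absNorm_pow_mul_pow_inv` — `(v ↦ N(v)^j ψ(v)^{−n})~(𝔞) = N𝔞^j ψ̃(𝔞)^{−n}`;
* ★ `hasSum_rayClassCoeff_twoIndex` — the series `Σ_𝔞 (χ⁻¹N^jψ^{−(j+k)})~(𝔞)` over the ideals prime to `𝔪`
  converges to `((k−1)!·A₀^j·Ω̄^j)⁻¹·Ω^k·Σ_{𝔠∈T} χ̃𝔠⁻¹·ψ̃𝔠^{−(j+k)}·E_{−j,k}(Ω, L 𝔠)`;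
* ★★ `sum_eisensteinKronecker_eq_rayClassLSeries_zero` —
  **`Σ_{𝔠∈T} χ̃(𝔠)⁻¹·ψ̃(𝔠)^{−(j+k)}·E_{−j,k}(Ω, L 𝔠) = (k−1)!·A₀^j·Ω̄^j·Ω^{−k}·rayClassLSeries 𝔪 (χ⁻¹N^jψ^{−(j+k)}) 0`**
  — de Shalit's `L_𝔣(ε⁻¹, 0)` for `ε = φ^kφ̄^{−j}χ` (II.4.14 (36), before `G(ε)(1 − ε(𝔭)/p)` and the period
  normalisation `(√d_K/2π)^j`, which is `A₀^j·|Ω|^{2j}·N𝔪^j` up to the root of unity, II.2.1 (6)).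

NOT here: the evaluation `A₀ = 2π/(N𝔪·|Ω|²·√|d_K|)`; weights `k − j ≤ 2`.
`-- TODO(general form): all 0 ≤ −j < k (Hecke's trick), A₀ evaluated.`

References: E. de Shalit (1987), II.3.5 (13) (p. 54), II.4.14 (36)–(42) (p. 71–73), II.2.1 (4)–(6) (p. 41)
[deShalit1987].

Mathlib / tree search: tree `PeriodPair.eisensteinKronecker_eq_tsum_rayClass`,
`PeriodPair.summable_conj_pow_mul_idealPow_inv_rayClass`, `LFunctions.conj_idealPow_pow_mul_inv_pow`,
`LFunctions.idealPow_mul_conj_eq_absNorm`, `idealPow_inv_fun`, `GrossencharakterAlgebra.idealPow_mul_fun'`,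
`idealPow_absNorm`, `IsRayClassReps`, `IsRayClassCharacter.idealPow_eq_of_rayClassRel`; Mathlib
`hasSum_subtype_iff_indicator`, `hasSum_sum` (`lean search 'eisensteinKronecker.*rayClassLSeries'` — nothing).
-/

noncomputable section

open scoped nonZeroDivisors Nat ComplexConjugate
open NumberField IsDedekindDomain Complex

namespace Literature.NumberTheory.EllipticCurves

open Literature.NumberTheory.LFunctions Literature.NumberTheory.GaloisRepresentations

variable {K : Type} [Field K] [NumberField K]

/-! ### §1. Coefficients -/

section Coefficients

variable {𝔪 : Ideal (𝓞 K)} {ψ χ : HeightOneSpectrum (𝓞 K) → ℂ}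

/-- `(ψ^n)~(𝔞) = ψ̃(𝔞)^n` on a nonzero ideal (restated privately; the tree's `idealPow_pow_fun`).
[cite: NeukirchANT1999, Ch. VII §6 Def. (6.8)] -/
private theorem idealPow_fun_pow' (ψ : HeightOneSpectrum (𝓞 K) → ℂ) (n : ℕ) {I : Ideal (𝓞 K)} (hI : I ≠ ⊥) :
    idealPow K (fun v ↦ ψ v ^ n) I = idealPow K ψ I ^ n := by
  unfold idealPow
  rw [finprod_pow (mulSupport_idealPow_finite ψ hI)]
  exact finprod_congr fun v ↦ by rw [← pow_mul, ← pow_mul, mul_comm]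

/-- **`(v ↦ N(v)^j·ψ(v)^{−n})~(𝔞) = N𝔞^j·ψ̃(𝔞)^{−n}`** on a nonzero ideal — the coefficient
`φ̄^j φ^{−k} = N^j φ^{−(k+j)}` of `L_𝔣(ε⁻¹, s)`, `ε = φ^kφ̄^{−j}χ`, in ideal currency.
[cite: deShalit1987, II.4.14 (36)] -/
theorem idealPow_absNorm_pow_mul_pow_inv (j n : ℕ) {I : Ideal (𝓞 K)} (hI : I ≠ ⊥) :
    idealPow K (fun v ↦ ((Ideal.absNorm v.asIdeal : ℕ) : ℂ) ^ j * (ψ v ^ n)⁻¹) I =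
      ((Ideal.absNorm I : ℕ) : ℂ) ^ j * (idealPow K ψ I ^ n)⁻¹ := by
  rw [idealPow_mul_fun' _ _ hI, idealPow_fun_pow' _ j hI, idealPow_absNorm hI,
    idealPow_inv_fun (fun v ↦ ψ v ^ n) I, idealPow_fun_pow' ψ n hI]

/-- **Splitting the coefficients of `L_𝔪(χ⁻¹·f, 0)` along a system of representatives** `T` of the ray
classes mod `𝔪`, for ANY multiplier `f` on the primes: `(χ⁻¹f)~(𝔞)·𝟙[(𝔞,𝔪)=1] = Σ_{𝔠∈T} 𝟙[𝔞∼𝔠]·χ̃(𝔠)⁻¹·f̃(𝔞)`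
(exactly one class, `χ̃` constant on it). [cite: deShalit1987, II.4.14 (38)] [cite: NeukirchANT1999, Ch. VII §8 (decomposition before (8.2))] -/
theorem rayClassCoeff_inv_mul_fun_eq_sum (h𝔪0 : 𝔪 ≠ ⊥) (hχ : IsRayClassCharacter 𝔪 χ)
    {T : Finset (Ideal (𝓞 K))} (hT : IsRayClassReps 𝔪 T) (f : HeightOneSpectrum (𝓞 K) → ℂ)
    (𝔞 : Ideal (𝓞 K)) :
    rayClassCoeff 𝔪 (fun v ↦ (χ v)⁻¹ * f v) 𝔞 =
      ∑ 𝔠 ∈ T, {𝔟 | RayClassRel 𝔪 𝔠 𝔟}.indicator (fun 𝔟 ↦ (idealPow K χ 𝔠)⁻¹ * idealPow K f 𝔟) 𝔞 := by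
  classical
  by_cases h𝔞 : 𝔞 ≠ ⊥ ∧ IsCoprime 𝔞 𝔪
  · obtain ⟨𝔠₀, h𝔠₀T, hrel⟩ := hT.exists_rel 𝔞 h𝔞.1 h𝔞.2
    rw [Finset.sum_eq_single_of_mem 𝔠₀ h𝔠₀T]
    · rw [Set.indicator_of_mem (by exact hrel), rayClassCoeff, if_pos h𝔞, idealPow_mul_fun' _ _ h𝔞.1,
        idealPow_inv_fun χ 𝔞, hχ.idealPow_eq_of_rayClassRel h𝔪0 hrel (hT.ne_bot_and_isCoprime 𝔠₀ h𝔠₀T).1]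
    · intro 𝔠 h𝔠T hne
      rw [Set.indicator_of_notMem]
      intro hrel'
      exact hne (hT.eq_of_rel 𝔠 h𝔠T 𝔠₀ h𝔠₀T ((show RayClassRel 𝔪 𝔠 𝔞 from hrel').trans hrel.symm))
  · rw [rayClassCoeff, if_neg h𝔞]
    refine (Finset.sum_eq_zero fun 𝔠 h𝔠T ↦ ?_).symm
    rw [Set.indicator_of_notMem]
    intro hrel
    have h𝔠 := hT.ne_bot_and_isCoprime 𝔠 h𝔠T
    exact h𝔞 ⟨(show RayClassRel 𝔪 𝔠 𝔞 from hrel).ne_bot_iff.mpr h𝔠.1,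
      (show RayClassRel 𝔪 𝔠 𝔞 from hrel).isCoprime_iff.mpr h𝔠.2⟩

end Coefficients

/-! ### §2. The class sum for `E_{−j,k}`, `k ≥ j + 3` -/

section ClassSum

variable [IsTotallyComplex K] {ιK : K →+* ℂ} {𝔪 : Ideal (𝓞 K)} {ψ χ : HeightOneSpectrum (𝓞 K) → ℂ}
  {Ω A₀ : ℂ}

/-- ★ **The series `Σ_𝔞 (χ⁻¹N^jψ^{−(j+k)})~(𝔞)` over the ideals prime to `𝔪` converges, class by class, to the
Eisenstein–Kronecker numbers** (`K` imaginary quadratic, `k ≥ j + 3`, hypotheses as in the module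
docstring): its sum is `((k−1)!·A₀^j·Ω̄^j)⁻¹·Ω^k·Σ_{𝔠∈T} χ̃𝔠⁻¹·ψ̃𝔠^{−(j+k)}·E_{−j,k}(Ω, L 𝔠)`. Per class this
is `eisensteinKronecker_eq_tsum_rayClass` with `conj(ψ̃𝔞)^j ψ̃𝔞^{−k} = N𝔞^jψ̃𝔞^{−(j+k)}` (`φφ̄ = N`) and
`A(L 𝔠)^j·conj(ψ̃𝔠)^{−j} = A₀^j·ψ̃𝔠^j`. [cite: deShalit1987, II.3.5 Proposition (13) and II.4.14 (36)–(39)] -/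
theorem hasSum_rayClassCoeff_twoIndex (h2 : Module.finrank ℚ K = 2) (h𝔪 : 𝔪 ≠ ⊤) (h𝔪0 : 𝔪 ≠ ⊥)
    (hw : ∀ u : (𝓞 K)ˣ, (u : 𝓞 K) - 1 ∈ 𝔪 → u = 1)
    (hψ0 : ∀ v : HeightOneSpectrum (𝓞 K), ¬ 𝔪 ≤ v.asIdeal → ψ v ≠ 0)
    (hψ : ∀ b c : 𝓞 K, b ≠ 0 → c ≠ 0 → IsCoprime (Ideal.span {c}) 𝔪 → b - c ∈ 𝔪 →
      idealPow K ψ (Ideal.span {b}) * ιK c = idealPow K ψ (Ideal.span {c}) * ιK b)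
    (hχ : IsRayClassCharacter 𝔪 χ) {T : Finset (Ideal (𝓞 K))} (hT : IsRayClassReps 𝔪 T)
    (hΩ : Ω ≠ 0) (L : Ideal (𝓞 K) → PeriodPair)
    (hL : ∀ 𝔠 ∈ T, ∀ z : ℂ, z ∈ (L 𝔠).lattice ↔
      ∃ x ∈ ((𝔪 : FractionalIdeal (𝓞 K)⁰ K) / (𝔠 : FractionalIdeal (𝓞 K)⁰ K)), z = Ω * ιK x)
    (hA : ∀ 𝔠 ∈ T, (L 𝔠).areaInv = ((Ideal.absNorm 𝔠 : ℕ) : ℂ) * A₀) (hA0 : A₀ ≠ 0)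
    {j k : ℕ} (hk : j + 3 ≤ k) :
    HasSum (fun 𝔞 : Ideal (𝓞 K) ↦ rayClassCoeff 𝔪
        (fun v ↦ (χ v)⁻¹ * (((Ideal.absNorm v.asIdeal : ℕ) : ℂ) ^ j * (ψ v ^ (j + k))⁻¹)) 𝔞)
      ((((k - 1)! : ℂ) * A₀ ^ j * conj Ω ^ j)⁻¹ * Ω ^ k *
        ∑ 𝔠 ∈ T, (idealPow K χ 𝔠)⁻¹ * (idealPow K ψ 𝔠 ^ (j + k))⁻¹ * (L 𝔠).eisensteinKronecker j k Ω) := by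
  classical
  rw [Finset.mul_sum]
  simp_rw [rayClassCoeff_inv_mul_fun_eq_sum h𝔪0 hχ hT]
  refine hasSum_sum fun 𝔠 h𝔠T ↦ ?_
  obtain ⟨h𝔠0, h𝔠cop⟩ := hT.ne_bot_and_isCoprime 𝔠 h𝔠T
  have hfac : ((k - 1)! : ℂ) ≠ 0 := by exact_mod_cast Nat.factorial_ne_zero _
  have hψ𝔠 : idealPow K ψ 𝔠 ≠ 0 := idealPow_ne_zero_of_isCoprime hψ0 h𝔠0 h𝔠cop
  have hcψ𝔠 : conj (idealPow K ψ 𝔠) ≠ 0 := (map_ne_zero _).mpr hψ𝔠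
  have hcΩ : conj Ω ≠ 0 := (map_ne_zero _).mpr hΩ
  have hN𝔠 : ((Ideal.absNorm 𝔠 : ℕ) : ℂ) ≠ 0 := by
    have : Ideal.absNorm 𝔠 ≠ 0 := by rwa [Ne, Ideal.absNorm_eq_zero_iff]
    exact_mod_cast this
  have hAL : (L 𝔠).areaInv ≠ 0 := by rw [hA 𝔠 h𝔠T]; exact mul_ne_zero hN𝔠 hA0
  -- `φφ̄ = N` at `𝔠`
  have hconj𝔠 := idealPow_mul_conj_eq_absNorm h2 ιK h𝔪0 hψ0 hψ h𝔠0 h𝔠cop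
  -- the class of `𝔠`: E_{−j,k} = C_𝔠 · Σ' conj(ψ̃𝔞)^j ψ̃𝔞^{−k}
  have hE := PeriodPair.eisensteinKronecker_eq_tsum_rayClass h𝔪 hw h𝔠cop hψ0 hψ hΩ (hL 𝔠 h𝔠T) hk
  have hS := (PeriodPair.summable_conj_pow_mul_idealPow_inv_rayClass h𝔪 hw h𝔠cop hψ0 hψ hΩ (hL 𝔠 h𝔠T)
    hAL hk).hasSum
  -- rewrite the class series termwise: conj(ψ̃𝔞)^j ψ̃𝔞^{−k} = N𝔞^j ψ̃𝔞^{−(j+k)}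
  have hterm : ∀ 𝔞 : {𝔞 : Ideal (𝓞 K) // RayClassRel 𝔪 𝔠 𝔞},
      conj (idealPow K ψ (𝔞 : Ideal (𝓞 K))) ^ j * (idealPow K ψ (𝔞 : Ideal (𝓞 K)) ^ k)⁻¹ =
        idealPow K (fun v ↦ ((Ideal.absNorm v.asIdeal : ℕ) : ℂ) ^ j * (ψ v ^ (j + k))⁻¹) 𝔞 := by
    intro 𝔞
    have h𝔞0 : (𝔞 : Ideal (𝓞 K)) ≠ ⊥ := 𝔞.2.ne_bot_iff.mpr h𝔠0
    rw [idealPow_absNorm_pow_mul_pow_inv j (j + k) h𝔞0,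
      conj_idealPow_pow_mul_inv_pow h2 ιK h𝔪0 hψ0 hψ h𝔞0 (𝔞.2.isCoprime_iff.mpr h𝔠cop) j k]
  -- the rescaled class series
  have h := hS.mul_left ((idealPow K χ 𝔠)⁻¹)
  have hfun : (fun 𝔞 : {𝔞 : Ideal (𝓞 K) // RayClassRel 𝔪 𝔠 𝔞} ↦
      (idealPow K χ 𝔠)⁻¹ * (conj (idealPow K ψ (𝔞 : Ideal (𝓞 K))) ^ j *
        (idealPow K ψ (𝔞 : Ideal (𝓞 K)) ^ k)⁻¹)) =
      (fun 𝔟 : Ideal (𝓞 K) ↦ (idealPow K χ 𝔠)⁻¹ *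
        idealPow K (fun v ↦ ((Ideal.absNorm v.asIdeal : ℕ) : ℂ) ^ j * (ψ v ^ (j + k))⁻¹) 𝔟) ∘
        ((↑) : {𝔞 : Ideal (𝓞 K) // RayClassRel 𝔪 𝔠 𝔞} → Ideal (𝓞 K)) := by
    funext 𝔞
    simp only [Function.comp_apply, hterm 𝔞]
  rw [hfun] at h
  have h' := (hasSum_subtype_iff_indicator (s := {𝔟 : Ideal (𝓞 K) | RayClassRel 𝔪 𝔠 𝔟})
    (f := fun 𝔟 : Ideal (𝓞 K) ↦ (idealPow K χ 𝔠)⁻¹ *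
      idealPow K (fun v ↦ ((Ideal.absNorm v.asIdeal : ℕ) : ℂ) ^ j * (ψ v ^ (j + k))⁻¹) 𝔟)).mp h
  convert h' using 1
  -- the value: `C⁻¹Ω^k·χ̃𝔠⁻¹ψ̃𝔠^{−(j+k)}·E = χ̃𝔠⁻¹·S` with `E = (k−1)!A^jΩ̄^jΩ^{−k}conj(ψ̃𝔠)^{−j}ψ̃𝔠^k·S`
  rw [hE, hA 𝔠 h𝔠T]
  have hcj : (conj (idealPow K ψ 𝔠) ^ j)⁻¹ * ((Ideal.absNorm 𝔠 : ℕ) : ℂ) ^ j = (idealPow K ψ 𝔠 ^ j) := by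
    rw [← inv_pow, ← mul_pow]
    congr 1
    rw [← hconj𝔠]
    field_simp
  set S := ∑' 𝔞 : {𝔞 : Ideal (𝓞 K) // RayClassRel 𝔪 𝔠 𝔞},
    conj (idealPow K ψ (𝔞 : Ideal (𝓞 K))) ^ j * (idealPow K ψ (𝔞 : Ideal (𝓞 K)) ^ k)⁻¹
  calc (((k - 1)! : ℂ) * A₀ ^ j * conj Ω ^ j)⁻¹ * Ω ^ k *
        ((idealPow K χ 𝔠)⁻¹ * (idealPow K ψ 𝔠 ^ (j + k))⁻¹ *
          (((k - 1)! : ℂ) * (((Ideal.absNorm 𝔠 : ℕ) : ℂ) * A₀) ^ j * conj Ω ^ j * (Ω ^ k)⁻¹ *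
            (conj (idealPow K ψ 𝔠) ^ j)⁻¹ * idealPow K ψ 𝔠 ^ k * S))
      = (idealPow K χ 𝔠)⁻¹ * S * ((idealPow K ψ 𝔠 ^ (j + k))⁻¹ * idealPow K ψ 𝔠 ^ k *
          ((conj (idealPow K ψ 𝔠) ^ j)⁻¹ * ((Ideal.absNorm 𝔠 : ℕ) : ℂ) ^ j)) := by
        field_simp
        ring
    _ = (idealPow K χ 𝔠)⁻¹ * S := by
        rw [hcj, pow_add, mul_inv, mul_assoc ((idealPow K ψ 𝔠 ^ j)⁻¹), inv_mul_cancel₀ (pow_ne_zero _ hψ𝔠),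
          mul_one, inv_mul_cancel₀ (pow_ne_zero _ hψ𝔠), mul_one]

/-- ★★ **de Shalit II.3.5 (13) summed over the ray classes for `E_{−j,k}`, `k ≥ j + 3`** (`K` imaginary
quadratic): `Σ_{𝔠∈T} χ̃(𝔠)⁻¹·ψ̃(𝔠)^{−(j+k)}·E_{−j,k}(Ω, L 𝔠) = (k−1)!·A₀^j·Ω̄^j·Ω^{−k}·L_𝔪(χ⁻¹N^jψ^{−(j+k)}, 0)`,
the `L`-series `rayClassLSeries 𝔪 (v ↦ χ(v)⁻¹N(v)^jψ(v)^{−(j+k)})` converging at `s = 0`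
(`hasSum_rayClassCoeff_twoIndex`) — de Shalit's `L_𝔣(ε⁻¹, 0)` for `ε = φ^kφ̄^{−j}χ` in II.4.14 (36).
[cite: deShalit1987, II.3.5 Proposition (13) and II.4.14 (36)] -/
theorem sum_eisensteinKronecker_eq_rayClassLSeries_zero (h2 : Module.finrank ℚ K = 2) (h𝔪 : 𝔪 ≠ ⊤)
    (h𝔪0 : 𝔪 ≠ ⊥) (hw : ∀ u : (𝓞 K)ˣ, (u : 𝓞 K) - 1 ∈ 𝔪 → u = 1)
    (hψ0 : ∀ v : HeightOneSpectrum (𝓞 K), ¬ 𝔪 ≤ v.asIdeal → ψ v ≠ 0)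
    (hψ : ∀ b c : 𝓞 K, b ≠ 0 → c ≠ 0 → IsCoprime (Ideal.span {c}) 𝔪 → b - c ∈ 𝔪 →
      idealPow K ψ (Ideal.span {b}) * ιK c = idealPow K ψ (Ideal.span {c}) * ιK b)
    (hχ : IsRayClassCharacter 𝔪 χ) {T : Finset (Ideal (𝓞 K))} (hT : IsRayClassReps 𝔪 T)
    (hΩ : Ω ≠ 0) (L : Ideal (𝓞 K) → PeriodPair)
    (hL : ∀ 𝔠 ∈ T, ∀ z : ℂ, z ∈ (L 𝔠).lattice ↔
      ∃ x ∈ ((𝔪 : FractionalIdeal (𝓞 K)⁰ K) / (𝔠 : FractionalIdeal (𝓞 K)⁰ K)), z = Ω * ιK x)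
    (hA : ∀ 𝔠 ∈ T, (L 𝔠).areaInv = ((Ideal.absNorm 𝔠 : ℕ) : ℂ) * A₀) (hA0 : A₀ ≠ 0)
    {j k : ℕ} (hk : j + 3 ≤ k) :
    ∑ 𝔠 ∈ T, (idealPow K χ 𝔠)⁻¹ * (idealPow K ψ 𝔠 ^ (j + k))⁻¹ * (L 𝔠).eisensteinKronecker j k Ω =
      ((k - 1)! : ℂ) * A₀ ^ j * conj Ω ^ j * (Ω ^ k)⁻¹ *
        rayClassLSeries 𝔪 (fun v ↦ (χ v)⁻¹ * (((Ideal.absNorm v.asIdeal : ℕ) : ℂ) ^ j * (ψ v ^ (j + k))⁻¹)) 0 := by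
  have h := (hasSum_rayClassCoeff_twoIndex h2 h𝔪 h𝔪0 hw hψ0 hψ hχ hT hΩ L hL hA hA0 hk).tsum_eq
  have hfac : ((k - 1)! : ℂ) ≠ 0 := by exact_mod_cast Nat.factorial_ne_zero _
  have hcΩ : conj Ω ≠ 0 := (map_ne_zero _).mpr hΩ
  have hL0 : rayClassLSeries 𝔪 (fun v ↦ (χ v)⁻¹ * (((Ideal.absNorm v.asIdeal : ℕ) : ℂ) ^ j * (ψ v ^ (j + k))⁻¹)) 0 =
      ∑' 𝔞 : Ideal (𝓞 K), rayClassCoeff 𝔪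
        (fun v ↦ (χ v)⁻¹ * (((Ideal.absNorm v.asIdeal : ℕ) : ℂ) ^ j * (ψ v ^ (j + k))⁻¹)) 𝔞 := by
    unfold rayClassLSeries
    exact tsum_congr fun 𝔞 ↦ by rw [neg_zero, Complex.cpow_zero, mul_one]
  rw [hL0, h]
  field_simp

end ClassSum

end Literature.NumberTheory.EllipticCurves

end
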